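import Mathlib
import HarnessLib
import HarnessLib.Audit
import Summits.AtomisticToContinuum.Statement
import Literature.MathematicalPhysics.StatisticalMechanics.BarlowStacking
import Literature.Geometry.DiscreteGeometry.KissingPatterns
import Literature.Geometry.DiscreteGeometry.FlyspeckL12
import Literature.Geometry.DiscreteGeometry.FejesTothKissingTwelve

/-!
Route: SquareWellJamming

CLOSED (retired) 2026-08-15T13:46:45Z by operator:999:1257524 — reason: not-a-thesis: assembly does not conclude the sub-problem Statement — note: D-0027 §2.1 audit (human 2026-08-15: routes that do not decide the summit are removed): the assembly concludes `SquareWellCrystallizes`, not the sub-problem statement; a NEW conforming route may be opened from the same idea (generated `closes : … → _root_.Crystallization`).. The file is kept as the record of this route; refuted decls are indexed as negative knowledge (`ledger negatives`).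

# Route SquareWellJamming — square wells for free — strict jamming of the Barlow contact truss pins
flat-well bonds at exact contact, so the adhesive rung survives a flat well plus CM tail (RUNG, no
LJ assembly)

RUNG ROUTE (realises card square-wells-for-free-jamming-pins-bonds; honest terminus = its own
Target, NOT the Lennard-Jones conjunct —
Literature.Barriers.AtomisticToContinuum.LocalizedPotentialsExcludeLennardJones applies in spirit).
Model: the square-well-plus-tail pair potential
V(r) = M (r < 1, finite wall), −1 on the FLAT well 1 ≤ r ≤ 1+w, −δ·r^(−s) for r > 1+w (attractive
completely monotone tail, s > 4), characterised
in Lean by three hypotheses on V : ℝ → ℝ. Target (SquareWellCrystallizes): for w below a threshold,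
every s > 4, δ below δ₀(w,s) and M above
M₀, BOTH Blanc–Lewin conjuncts hold for V in ℝ³ (HasPeriodicGroundStateEnergy V 3 ∧ IsCrystallizing
V 3; the periodic minimiser is hcp at
exact contact). It suffices to show X = DeepBondsAreContacts ∧ FlatWellPeriodicMinimum: (crux 2) in
a ground state every bond (pair at distance
≤ 1+w) whose neighbourhood of radius L consists of 12-bonded, overlap-free particles is an EXACT
contact (the flat well collapses to the delta
well dynamically: the only energy that sees bond lengths is the decreasing tail, and the Barlow
contact truss is strictly jammed, so opening
contacts lengthens Σ r at first order with strictly positive multipliers); (crux 3) the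
boundary-free shadow: exact-contact hcp is a least
element of the energy per particle over ALL periodic configurations of the flat-well model. Given X,
the supports SoftShellsAreBarlow (qualitative
robust kissing classification from flyspeck_L12 + Hales2012_kissingConfigCongruent, by compactness),
WallGroundStates (vacuity guard: ground
states exist and are unit packings) and AdhesiveHandover (the adhesive-rung bookkeeping of card
adhesive-spheres-weak-cm-tail run at exact contact:
contact budget −#bonds ≥ −6N + ½#bad, interfacial charging with the s > 4 threshold, extension
comparison + monotone pairing, pigeonhole windows)
give the Target.
Lean: `∃ w₀ : ℝ, 0 < w₀ ∧ ∀ w : ℝ, 0 < w → w ≤ w₀ → ∀ s : ℝ, 4 < s → ∃ δ₀ : ℝ, 0 < δ₀ ∧ ∀ δ : ℝ, 0 <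
δ → δ < δ₀ → ∃ M₀ : ℝ, ∀ M : ℝ, M₀ ≤ M → ∀ V : ℝ → ℝ, (∀ r, r < 1 → V r = M) → (∀ r, 1 ≤ r → r ≤ 1 +
w → V r = -1) → (∀ r, 1 + w < r → V r = -(δ * r ^ (-s))) →
Literature.MathematicalPhysics.StatisticalMechanics.HasPeriodicGroundStateEnergy V 3 ∧
Literature.MathematicalPhysics.StatisticalMechanics.IsCrystallizing V 3`

## Assembly
Pure logic (modus ponens; `assembly_provable : Assembly := fun a b c d h => h a b c d`, sorry-free
in the planner's Sketch.lean, lean check rc 0,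
axioms propext/Classical.choice/Quot.sound): the two cruxes and the two stand-alone supports feed
AdhesiveHandover, whose consequent is the Target.
The chain ends at the route's own Target SquareWellCrystallizes (a RUNG two steps from V_LJ): NO
implication to the sub-problem constant
`Crystallization` (Lennard-Jones) is claimed or filed — what transfers to LJ lines is
DeepBondsAreContacts/FlatWellPeriodicMinimum as the jamming
"last mile" of hard-core routes (MieLadderVdwKissing cruxes 4–5, theta-universality-packings,
kepler-stability-edge-of-summability).

Rationale: WHY THIS LINE. The adhesive rung (Radin1981 one dimension up: sticky contact + weak CM tail, card
adhesive-spheres-weak-cm-tail) needs a DELTA well so that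
"bond = contact" and Hales's η = 0 theorems apply; this line removes the delta by a mechanism from
rigidity theory rather than by energetics:
a flat well is indifferent to bond length, the tail is decreasing in every distance, and the Barlow
contact network is a strut tensegrity
carrying a strictly positive self-stress (RothWhiteley1981, ConnellyWhiteley1996; uniform stability
of all Barlow packings BezdekBezdekConnelly1998
Thm 2.7.1; LP jamming test DonevEtAl2004, TorquatoStillinger2001), so contact-opening motions cost
tail energy at FIRST order — the bulk identity
Σ_b dr_b = Σ_i d_i·Σ_(b∋i) r̂_b = 0 (twelve unit bond vectors sum to zero at every Barlow site)
makes every bond-non-negative compactly supported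
first-order motion a flex, hence trivial. Imported: tensegrity/jamming rigidity (first-order
rigidity = bar rigidity + proper stress; prestress
stability HolmescerfonTheranGortler2020, whose sticky version needs curvature at the well bottom
that a flat well lacks — here the tail supplies
the stress) into a Blanc–Lewin ground-state problem; soft kissing ≤ 12 within 1.0199 is in tree
(card_le_twelve_of_norm_le from flyspeck_L12;
Tammes-13 MusinTarasov2012 gives 1.0455). No prior route treats a flat well:
CrystalKissingRigidity/CrystalThreeCone/HullPeriodicPoint attack
V_LJ directly, MieLadderVdwKissing invokes the same positive-multiplier structure for its Sutherland
rung and descent (cruxes 4–5) but files no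
pinning statement; DeepBondsAreContacts is the flat-well twin of that step. Negatives index: empty
at filing.

RANKED CRUXES. #0 SquareWellCrystallizes (target) — ∃ w₀ > 0 such that for all 0 < w ≤ w₀ and s > 4
there is δ₀ > 0 such that for 0 < δ < δ₀ there is M₀ with: for every M ≥ M₀ and every V with V = M
on r < 1, V = −1 on [1, 1+w], V(r) = −δ r^(−s) for r > 1+w, HasPeriodicGroundStateEnergy V 3 ∧
IsCrystallizing V 3 (card Assembly sketch, Lean-statable without a definition request). (why it
might fail: δ₀(w,s) must absorb the tail slack of bad, boundary-good AND un-pinned (depth < L)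
particles, so δ₀ ~ 1/(C·L³) may be absurdly small (true-but-silly); fails outright if pinning has no
N-uniform depth (crux 2) or if hcp is not the periodic minimiser (crux 3).) [Radin1981,
BlancLewin2015, Hales2012, BezdekBezdekConnelly1998, KubinPonsiglione2021]
#2 DeepBondsAreContacts (crux) — (card W4/J3, depth form) ∃ w₁ > 0, ∀ 0 < w ≤ w₁, ∀ s > 4, ∃ L, ∀ δ
> 0, ∀ M, for the flat-well potential V and every N-particle ground state x: if i ≠ j, dist(x_i,x_j)
≤ 1+w, and every particle k within distance L of x_i is overlap-free (all others at distance ≥ 1)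
and has EXACTLY twelve others within 1+w, then dist(x_i,x_j) = 1. δ-free because inside a good
region only the tail sees positions; L may depend on (w,s) but not on N, δ, M. [difficulty: XL] (why
it might fail: Across a defective interface the exterior pulls a good grain in tension; a no-tension
(slack-strut) network may open bonds to a depth growing with grain size (arching, stress channels),
so no L uniform in N; slowly varying bond-non-negative strains near loaded boundaries = the card's
risk (b).) [BezdekBezdekConnelly1998, RothWhiteley1981, ConnellyWhiteley1996, DonevEtAl2004,
TorquatoStillinger2001, HolmescerfonTheranGortler2020, KusnerKusnerLagariasShlosman2018]
#3 FlatWellPeriodicMinimum (crux) — (boundary-free shadow of the mechanism + selection) ∃ w₂ > 0, ∀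
0 < w ≤ w₂, ∀ s > 4, ∃ δ₀ > 0, ∀ 0 < δ < δ₀, ∃ M₀, ∀ M ≥ M₀, for the flat-well potential V: the
exact-contact hcp configuration hcpPeriodicConfiguration (a = 1, h = √(2/3)) is a LEAST element of Q
↦ e_V(Q) over all periodic configurations Q of ℝ³ (ties allowed). Content: soft kissing caps bonds
at 12 per site (½ lost per non-12-bonded motif site beats any tail gain for δ < δ₀); all-12-bonded
periodic packings have Barlow shells (SoftShellsAreBarlow) hence are w-realisations of a Barlow
graph; first-order tail cost c·δ·tr ε > 0 of every bond-non-negative strain (Σ_b r̂_b⊗r̂_b = 4·Id)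
dominates inside the O(w) realisation space (periodic pinning, no minimality of Q used); among exact
Barlow stackings hcp maximises the CM tail site by site (monotone pairing,
BeterminPetrache2017-type). [difficulty: L] (why it might fail: Holds for ALL periodic Q, not
minimisers: the first-order cost c·δ·tr ε must beat O(δ·w·|ε|) uniformly over supercells and Hägg
words (uniform truss Korn constant; a long-wavelength bond-non-negative soft mode breaks it), and δ₀
must absorb tail-rich 11-bonded or non-Barlow motifs.) [BezdekBezdekConnelly1998,
BeterminPetrache2017, Hales2012, MusinTarasov2012, Stillinger2001, BlancLewin2015]
#9 SoftShellsAreBarlow (support) — (card W2, qualitative robust Fejes Tóth at position level, by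
compactness from the η = 0 theorems taken as hypotheses) flyspeck_L12 →
Hales2012_kissingConfigCongruent → ∀ ε > 0 ∃ w₀ > 0: in any unit packing S ⊂ ℝ³ (pairwise ≥ 1), if x
∈ S and every point of S within 1+w₀ of x (x included) has exactly twelve points of S within 1+w₀,
then the recentred twelve-shell of x is ShellCloseTo ε to fccKissingPattern or to hcpKissingPattern.
Locality holds: Hales's Lemma 2 gap at x and at each neighbour needs only their own twelve-shells
(L12), then Lemma 9/10 classify the shell; w₀(ε) is non-effective. [difficulty: L] [Hales2012,
HalesDSP2012, BoroczkySzabo2016, KusnerKusnerLagariasShlosman2018]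
#9 WallGroundStates (support) — (card W1/A1 analogue, vacuity guard) for 0 < w ≤ 1, s > 4, 0 < δ < 1
there is M₀ such that for M ≥ M₀ and the flat-well potential V, for every N: a ground state exists
(V is lower semicontinuous; translation/cluster tightness) and every ground state is a unit packing
(pairwise distances ≥ 1: an overlapping particle relocated to the hull touching one extremal
particle gains, by a Turán-type count of overlaps among > 28 points in a ball of radius 1.02).
[difficulty: M] [BlancLewin2015, Theil2006, HeitmannRadin1980]
#9 AdhesiveHandover (support) — the hand-over (card W5): DeepBondsAreContacts →
FlatWellPeriodicMinimum → SoftShellsAreBarlow → WallGroundStates → SquareWellCrystallizes. Mechanism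
= the adhesive rung's bookkeeping run at exact contact inside L-deep good regions: budget −#bonds ≥
−6N + ½#bad (soft kissing, tree card_le_twelve_of_norm_le for w ≤ 0.0199), un-pinned shell of depth
L charged to #bad, interfacial charging of cross tail terms (finite iff s > 4) ⇒ #bad ≤ C N^(2/3)/(½
− C″δ); extension comparison + per-site monotone pairing ⇒ #fcc-like sites ≤ C N^(2/3)/δ; pigeonhole
⇒ exact rotated hcp ball of radius ≍ N^(1/9) ⇒ IsCrystallizing (rotation extraction,
tendsto_sum_of_eventually_near'); two-sided bounds ⇒ E(N)/N → e_V(hcp) and FlatWellPeriodicMinimum ⇒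
HasPeriodicGroundStateEnergy. [difficulty: XL] [Radin1981, KubinPonsiglione2021,
BeterminPetrache2017, Hales2012, BlancLewin2015]

TWO-LAYER PLAN. Foreseen glued splits (nothing filed now): DeepBondsAreContacts ⇐
LocalJammingPenalty (exact Barlow fragments are strict local minimisers, with
LINEAR growth, of any energy Σφ(r_ij) with φ' < 0 over {r_b ≥ 1 on bonds}, frozen rim: bar rigidity
of the octet-type truss on B_R inside B_2R
+ strictly positive resolving stress by Farkas from Σ_b dr_b = boundary flux) → NoTensionDepthBound
(under exterior loads O(δ) per boundary site
the slack layer has depth ≤ L(w,s)) → DeepBondsAreContacts. FlatWellPeriodicMinimum ⇐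
PeriodicPinning (tail per site of any periodic
w-realisation of a Barlow graph ≤ that of its exact realisation) → BarlowSiteMonotonePairing (exact
hcp site maximises the CM tail among Barlow
sites) → FlatWellPeriodicMinimum. The card's W3 'uniform unilateral Korn' is NOT an item: |dr_b| ≤ η
+ Σ(dr)₊ makes it the bilateral truss Korn
inequality (octet-truss-korn-jitterbug T3; BezdekBezdekConnelly1998 Thm 2.7.1) with finitely many
local patterns per radius — a --supports lemma
of LocalJammingPenalty.

KILL CRITERIA. Refutation of DeepBondsAreContacts by an explicit family of ground states (or
frozen-exterior minimisers) whose slack-bond layer deepens with grain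
size closes the route (`refuted:DeepBondsAreContacts`) and downgrades the jamming 'last mile' of
MieLadderVdwKissing to depth-o(N^(1/3)) form. A
periodic flat-well configuration beating exact hcp (refutes FlatWellPeriodicMinimum) forces a pivot:
if the winner is a w-distorted polytype the
thesis is dead (flat wells are NOT free); if it is an exact non-hcp stacking only the selection step
(monotone pairing) is wrong and the Target
survives with another P. SoftShellsAreBarlow refuted (quasi-twelve-neighbour packings persisting as
w → 0 under exact hard core and exact-12
counts, BoroczkySzabo2016-type) kills every compactness-based rung incl. this one. If route
MieLadderVdwKissing proves its descent with an
explicit pinning lemma, DeepBondsAreContacts at w = 0⁺ is mooted into a corollary.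

NOT DECOMPOSED YET. The constants: L(w,s), δ₀ ~ 1/(C″L³), w-thresholds (w₁, w₂ vs the Tammes margin
0.0455 and the tree's 0.0199), M₀ (Turán count); the conic/
bilateral Korn constant of the truss and its growth in R; the frozen-rim vs free-boundary versions
of the local jamming penalty; the s ∈ (3,4]
regime (tails not interfacial; excluded by hypothesis); the repulsive-tail twin (+δ r^(−s) ⇒ fcc)
and wider wells up to the Tammes margin via a
MusinTarasov2012 cite fact; sharing AdhesiveHandover's lemmas with a future adhesive-rung route
(same bookkeeping at w = 0). All layer-2, after
crux 2 or 3 moves.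

CHEAPEST FALSIFIER. PERIODIC PINNING NUMERICS (kills crux 3 and the whole 'for free' slogan): in a
2×2×4 (or 3×3×6) supercell of hcp, dhcp and fcc at contact,
maximise the tail sum Σ r^(−6) over displacements subject to r_b ∈ [1, 1+w] on the 12-bond graph and
r ≥ 1 otherwise (w = 0.02; nonlinear
program with a few hundred variables, multistart) — any maximiser with a stretched bond, or any
distorted dhcp/fcc cell beating exact hcp per
site (margin to beat: hcp−fcc ≈ 1e-3 of the tail, D₂-scale 4e-4 per site), refutes
FlatWellPeriodicMinimum. Not run here (hub is compute-free
and this is a one-shot plancard pass); first refuter job. Second cheapest: the frozen-rim cluster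
version for crux 2 (a 3-shell hcp ball with the
outer shell displaced outward by w: does the tail-minimiser re-close the interior bonds?).

NUMBERS. Soft kissing: ≤ 12 centres pairwise ≥ 1 in the shell [1, 1.01995] (tree
card_le_twelve_of_norm_le, from flyspeck_L12, h = 2.0399/2); Tammes N = 13
radius 1.04557 (MusinTarasov2012) is the ceiling for any flat-well budget; soft gap from L12: no
neighbour in (1+w, 1.26 − 12w). Tail scales at
contact (s = 6, δ-units): L₆(hcp) = 14.45489, L₆(fcc) = 14.45392, first shell 12, so hcp−fcc ≈ 1e-3
and the aligned-minus-staggered layer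
difference |D₂| ≈ 4e-4 per site (cards poisson-bessel-stacking-selection /
adhesive-spheres-weak-cm-tail); Σ_b r̂_b ⊗ r̂_b = 4·Id at every Barlow
site (first-order tail cost of a bond-non-negative strain = δ·s·(L_s − 12)/3 · tr ε). Items at open:
7 (1 target, 2 cruxes, 3 support, 1 assembly).

DEFINITION REQUESTS. None blocking: the potential is characterised by hypotheses on V. Optional
convenience definition `squareWellTail (w s δ M : ℝ) : ℝ → ℝ` in
Literature/MathematicalPhysics/StatisticalMechanics (not filed; statements do not depend on it).
Cite fact wanted later (layer 2, wider wells):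
Tammes N = 13 (MusinTarasov2012: thirteen points on the unit sphere have minimal angular separation
≤ 57.1367°).

Novelty: Searches (2026-08-15): `lit search --source crossref "uniform stability sphere packings Bezdek
Connelly"` (8; BezdekBezdekConnelly1998 found, added
to bib); `lit search --source crossref "strictly jammed sphere packing fcc hcp Barlow linear
programming rigidity Donev Torquato Stillinger Connelly"`
(8: DonevEtAl2004, TorquatoStillinger2001, doi:10.1063/1.5129458 Stillinger–Torquato 2019 jammed hcp
with tunnels); `lit search --source crossref
"square well potential ground state clusters crystal structure narrow attractive well hard spheres
energy minimization"` (10, all liquid-state/EOS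
physics, no ground-state structure theorem); `lit cite 10.1002/cpa.21971`
(HolmescerfonTheranGortler2020 added); local searchd DOWN (connection
reset) and `lit galaxy search "strictly jammed" --star all` / `"tensegrity" --title-contains
packing` both rc 1 (galaxyd saturated > 90 s, two
attempts) — recorded, not worked around; the card's three refuter audits (R10/R12/R14) already ran
crossref/zbMATH/galaxy sweeps with the same nil
result for 'strut rigidity + positive tail multipliers pinning bonds in a flat well'.
Nearest prior art found: BezdekBezdekConnelly1998 (doi:10.1007/pl00009374) Thm 2.7.1/2.9.1 — all
Barlow packings uniformly stable (= the
qualitative rigidity half, no energy, no constant); HolmescerfonTheranGortler2020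
(doi:10.1002/cpa.21971) — almost-rigidity/prestress stability
of frameworks and sticky-potential energies with curvature at the well bottom; DonevEtAl2004 — LP
strict-ja  [refs: 10.1063/1.5129458, 10.1002/cpa.21971`, 10.1007/pl00009374, 10.1002/cpa.21971, doi:10.1063/1.5129458, doi:10.1007/pl00009374, doi:10.1002/cpa.21971, BezdekBezdekConnelly1998, DonevEtAl2004, TorquatoStillinger2001, HolmescerfonTheranGortler2020, Radin1981]

Barriers (technique_class: unilateral-rigidity strict-jamming flat-well-pinning): - technique_class: unilateral-rigidity strict-jamming flat-well-pinning
- Literature.Barriers.AtomisticToContinuum.FlexibleKissingArrangements: evaded as in Hales (evasion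
(i)): shells are classified only under the padded hypothesis 'x AND its twelve neighbours are
12-bonded' (SoftShellsAreBarlow), and pinning is claimed only at depth L inside all-good regions,
never for one shell; the icosahedral witness has no bonds at all within 1+w for w < 0.05.
- Literature.Barriers.AtomisticToContinuum.KissingTwelveDegeneracy: respected — jamming pins
LENGTHS, never the stacking (every Hägg word is strictly jammed); the stacking is selected by the CM
tail beyond √(8/3) (monotone pairing inside FlatWellPeriodicMinimum / AdhesiveHandover), consistent
with ShortRangeStackingBlindness.
- Literature.Barriers.AtomisticToContinuum.StickySphereClusters: no finite-N exactness is claimed;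
O(N^(2/3)) arbitrary defects (incl. tetrahelical sticky motifs) are budgeted, and conclusions are
windows/limits only.
- Literature.Barriers.AtomisticToContinuum.LocalizedPotentialsExcludeLennardJones: it does not evade
it; the bet is a RUNG — a flat narrow well plus weak tail is not V_LJ and no continuation to LJ is
claimed; what transfers is the pinning lemma for hard-core lines (MieLadderVdwKissing's descent).
- Literature.Barriers.AtomisticToContinuum.TetrahedralFrustration: not met — no density or Voronoi
bound is used; frustration is priced upstream by the bond budget (½ per non-12-bonded particle).
- Lite

History (route lifecycle, newest last):
- 2026-08-15T13:46:45Z · CLOSED retired — not-a-thesis: assembly does not conclude the sub-problem Statement (operator:999:1257524)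

sub-problem: Crystallization · status: closed(retired) · opened planner-plancard-AtomisticToContinuum-Crystal-9355c08d-0 2026-08-15T11:43:21Z · rev 1 · ledger route-AtomisticToContinuum-SquareWellJamming
GENERATED by the gate from the ledger (D-0016/17). Provers cite these decls: `theorem foo : Summit.AtomisticToContinuum.Crystallization.Theses.SquareWellJamming.<Decl> := …` in Summits/AtomisticToContinuum/Crystallization/Theorems/<Name>.lean.
-/

namespace Summit.AtomisticToContinuum.Crystallization.Theses.SquareWellJamming

open scoped BigOperators Topology Manifold Classical MeasureTheory ProbabilityTheory Matrix InnerProductSpace ComplexConjugate ContinuousMap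
open Filter Set Function TopologicalSpace MeasureTheory

attribute [summit_statement] _root_.Crystallization

/-- item stmt-AtomisticToContinuum-5880 · target · rank 0 · closed · moot by None · by planner
why it might fail: δ₀(w,s) must absorb the tail slack of bad, boundary-good AND un-pinned (depth < L) particles, so δ₀ ~ 1/(C·L³) may be absurdly small (true-but-silly); fails outright if pinning has no N-uniform depth (crux 2) or if hcp is not the periodic minimiser (crux 3).
sources: Radin1981, BlancLewin2015, Hales2012, BezdekBezdekConnelly1998, KubinPonsiglione2021
[target] ∃ w₀ > 0 such that for all 0 < w ≤ w₀ and s > 4 there is δ₀ > 0 such that for 0 < δ < δ₀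
there is M₀ with: for every M ≥ M₀ and every V with V = M on r < 1, V = −1 on [1, 1+w], V(r) = −δ
r^(−s) for r > 1+w, HasPeriodicGroundStateEnergy V 3 ∧ IsCrystallizing V 3 (card Assembly sketch,
Lean-statable without a definition request). -/
@[route_item "route-AtomisticToContinuum-SquareWellJamming"]
def SquareWellCrystallizes : Prop :=
  ∃ w₀ : ℝ, 0 < w₀ ∧ ∀ w : ℝ, 0 < w → w ≤ w₀ → ∀ s : ℝ, 4 < s → ∃ δ₀ : ℝ, 0 < δ₀ ∧ ∀ δ : ℝ, 0 < δ → δ < δ₀ → ∃ M₀ : ℝ, ∀ M : ℝ, M₀ ≤ M → ∀ V : ℝ → ℝ, (∀ r, r < 1 → V r = M) → (∀ r, 1 ≤ r → r ≤ 1 + w → V r = -1) → (∀ r, 1 + w < r → V r = -(δ * r ^ (-s))) → Literature.MathematicalPhysics.StatisticalMechanics.HasPeriodicGroundStateEnergy V 3 ∧ Literature.MathematicalPhysics.StatisticalMechanics.IsCrystallizing V 3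

/-- item stmt-AtomisticToContinuum-5881 · crux · rank 2 · closed · moot by None · by planner
why it might fail: Across a defective interface the exterior pulls a good grain in tension; a no-tension (slack-strut) network may open bonds to a depth growing with grain size (arching, stress channels), so no L uniform in N; slowly varying bond-non-negative strains near loaded boundaries = the card's risk (b).
sources: BezdekBezdekConnelly1998, RothWhiteley1981, ConnellyWhiteley1996, DonevEtAl2004, TorquatoStillinger2001, HolmescerfonTheranGortler2020
[crux] (card W4/J3, depth form) ∃ w₁ > 0, ∀ 0 < w ≤ w₁, ∀ s > 4, ∃ L, ∀ δ > 0, ∀ M, for the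
flat-well potential V and every N-particle ground state x: if i ≠ j, dist(x_i,x_j) ≤ 1+w, and every
particle k within distance L of x_i is overlap-free (all others at distance ≥ 1) and has EXACTLY
twelve others within 1+w, then dist(x_i,x_j) = 1. δ-free because inside a good region only the tail
sees positions; L may depend on (w,s) but not on N, δ, M. [difficulty: XL] -/
@[route_item "route-AtomisticToContinuum-SquareWellJamming"]
def DeepBondsAreContacts : Prop :=
  ∃ w₁ : ℝ, 0 < w₁ ∧ ∀ w : ℝ, 0 < w → w ≤ w₁ → ∀ s : ℝ, 4 < s → ∃ L : ℝ, ∀ δ : ℝ, 0 < δ → ∀ (M : ℝ) (V : ℝ → ℝ), (∀ r, r < 1 → V r = M) → (∀ r, 1 ≤ r → r ≤ 1 + w → V r = -1) → (∀ r, 1 + w < r → V r = -(δ * r ^ (-s))) → ∀ (N : ℕ) (x : Fin N → EuclideanSpace ℝ (Fin 3)), Literature.MathematicalPhysics.StatisticalMechanics.IsGroundState V x → ∀ i j : Fin N, i ≠ j → dist (x i) (x j) ≤ 1 + w → (∀ k : Fin N, dist (x k) (x i) ≤ L → (∀ l : Fin N, l ≠ k → 1 ≤ dist (x k) (x l)) ∧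 Nat.card {l : Fin N // l ≠ k ∧ dist (x k) (x l) ≤ 1 + w} = 12) → dist (x i) (x j) = 1

/-- item stmt-AtomisticToContinuum-5882 · crux · rank 3 · closed · moot by None · by planner
why it might fail: Holds for ALL periodic Q, not minimisers: the first-order cost c·δ·tr ε must beat O(δ·w·|ε|) uniformly over supercells and Hägg words (uniform truss Korn constant; a long-wavelength bond-non-negative soft mode breaks it), and δ₀ must absorb tail-rich 11-bonded or non-Barlow motifs.
sources: BezdekBezdekConnelly1998, BeterminPetrache2017, Hales2012, MusinTarasov2012, Stillinger2001, BlancLewin2015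
[crux] (boundary-free shadow of the mechanism + selection) ∃ w₂ > 0, ∀ 0 < w ≤ w₂, ∀ s > 4, ∃ δ₀ >
0, ∀ 0 < δ < δ₀, ∃ M₀, ∀ M ≥ M₀, for the flat-well potential V: the exact-contact hcp configuration
hcpPeriodicConfiguration (a = 1, h = √(2/3)) is a LEAST element of Q ↦ e_V(Q) over all periodic
configurations Q of ℝ³ (ties allowed). Content: soft kissing caps bonds at 12 per site (½ lost per
non-12-bonded motif site beats any tail gain for δ < δ₀); all-12-bonded periodic packings have
Barlow shells (SoftShellsAreBarlow) hence are w-realisations of a Barlow graph; first-order tail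
cost c·δ·tr ε > 0 of every bond-non-negative strain (Σ_b r̂_b⊗r̂_b = 4·Id) dominates inside the O(w)
realisation space (periodic pinning, no minimality of Q used); among exact Barlow stackings hcp
maximises the CM tail site by site (monotone pairing, BeterminPetrache2017-type). [difficulty: L] -/
@[route_item "route-AtomisticToContinuum-SquareWellJamming"]
def FlatWellPeriodicMinimum : Prop :=
  ∃ w₂ : ℝ, 0 < w₂ ∧ ∀ w : ℝ, 0 < w → w ≤ w₂ → ∀ s : ℝ, 4 < s → ∃ δ₀ : ℝ, 0 < δ₀ ∧ ∀ δ : ℝ, 0 < δ → δ < δ₀ → ∃ M₀ : ℝ, ∀ M : ℝ, M₀ ≤ M → ∀ V : ℝ → ℝ, (∀ r, r < 1 → V r = M) → (∀ r, 1 ≤ r → r ≤ 1 + w → V r = -1) → (∀ r, 1 + w < r → V r = -(δ * r ^ (-s))) → ∃ (ha : (1 : ℝ) ≠ 0) (hh : Real.sqrt (2 / 3) ≠ 0), IsLeast (Set.range fun Q : Literature.MathematicalPhysics.StatisticalMechanics.PeriodicConfiguration 3 => Q.energyPerParticle V) ((Literature.MathematicalPhysics.StatisticalMechanics.hcpPeriodicConfiguration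 ha hh).energyPerParticle V)

/-- item stmt-AtomisticToContinuum-7915 · crux · rank 4 · closed · moot by None · by planner
why it might fail: Only known proof is computer-assisted (Flyspeck L12 + tame-hypermap enumeration + LPs): XL, may never land in Lean; and the LOCAL hypothesis (x and its twelve neighbours only) is our reading of Lemma 2's pointwise use of L12 — if that reading is wrong only the global kissing-twelve form is covered.
sources: Hales2012, HalesDSP2012, HalesEtAl2015, HalesFlyspeck2012, KusnerKusnerLagariasShlosman2018
[crux] [input fact, named per route-repair 2026-08-15] HALES 2012 THEOREM 1 IN LOCAL EXACT FORM
(unit-diameter normalisation): in any S ⊂ ℝ³ with pairwise distances ≥ 1, if x ∈ S and every point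
of S at distance ≤ 1 from x (x and its contact neighbours) has exactly twelve points of S at
distance exactly 1, then the recentred contact shell of x is the image of fccKissingPattern or of
hcpKissingPattern under a linear isometry (ShellCloseTo 0 …). This is the route's explicit,
self-contained statement of what it draws from the unproved Literature named facts flyspeck_L12
(Lemma 1 ⇒ Lemma 2, used pointwise at x's twelve neighbours) and Hales2012_kissingConfigCongruent
(Theorem 3 + Lemmas 9–10; ⇐ Hales2012_contactGraphFccOrHcp ⇐ Hales2012_contactGraphTame by proved
bridges), rescaled ×½ and stated over KissingPatterns + Mathlib only, so that — once
SoftShellsAreBarlow / FlatWellPeriodicMinimum / AdhesiveHandover / Assembly are restated onto it and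
the FlyspeckL12 + FejesTothKissingTwelve imports dropped (repair plan in the rrepair seat's folder:
Sketch.lean rc 0, edit files) — no unproved named fact sits in the route's import cone. The bridge
`flyspeck_L12 → Hales2012_kissingConfigCongru -/
@[route_item "route-AtomisticToContinuum-SquareWellJamming"]
def TwelveContactShellsClassified : Prop :=
  ∀ (S : Set (EuclideanSpace ℝ (Fin 3))) (x : EuclideanSpace ℝ (Fin 3)), x ∈ S → (∀ y ∈ S, ∀ z ∈ S, y ≠ z → 1 ≤ dist y z) → (∀ y ∈ S, dist x y ≤ 1 → {z ∈ S | z ≠ y ∧ dist y z ≤ 1}.ncard = 12) → ∃ T : Finset (EuclideanSpace ℝ (Fin 3)), (↑T : Set (EuclideanSpace ℝ (Fin 3))) = (fun y => y - x) '' {y ∈ S | y ≠ x ∧ dist x y ≤ 1} ∧ (Literature.Geometry.DiscreteGeometry.ShellCloseTo 0 T Literature.Geometry.DiscreteGeometry.fccKissingPattern ∨ Literature.Geometry.DiscreteGeometry.ShellCloseTo 0 T Literature.Geometry.DiscreteGeometry.hcpKissingPattern)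

/-- item stmt-AtomisticToContinuum-3617 · crux · rank 5 · closed · moot by None · by planner
why it might fail: Settled since 1953, so the risk is formal SIZE: every proof (Schütte–van der Waerden, Leech, Maehara, Musin LP, Bachoc–Vallentin SDP, Hales L12) is delicate spherical geometry or certified numerics with no Mathlib support — XL, may starve the rung of this input.
sources: SchutteVanderwaerden1952, Maehara2007, Musin2005, BachocVallentin2007, MusinTarasov2012, Hales2012
[crux] THE KISSING NUMBER OF ℝ³ IS TWELVE: at most 12 unit vectors with pairwise distances ≥ 1
(Schütte–van der Waerden; Leech; Musin; Bachoc–Vallentin). Load-bearing for the first-shell cap on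
every rung (with compactness: ∃ ε₁₂ > 0, no 13 points pairwise ≥ 1 in the shell [1, 1+ε₁₂] — all the
ladder needs since q₀ is free) and for every sphere-packing-heritage route of the summit; UNPROVED
IN LEAN (the tree has it only behind the named fact flyspeck_L12: card_le_twelve_of_flyspeck_L12,
not_packing_thirteen_of_L12). Filed as the route's FIRST crux by the plancard rule (unproved cone
fact ⇒ first crux explicitly) although it is a theorem in print; a retriage may rebadge it support
once a Lean proof lands. Card item S2. [difficulty: XL] -/
@[route_item "route-AtomisticToContinuum-SquareWellJamming"]
def KissingNumberTwelve : Prop :=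
  ∀ T : Finset (EuclideanSpace ℝ (Fin 3)), (∀ v ∈ T, ‖v‖ = 1) → (∀ v ∈ T, ∀ w ∈ T, v ≠ w → 1 ≤ dist v w) → T.card ≤ 12

/-- item stmt-AtomisticToContinuum-5883 · support · rank 9 · closed · moot by None · by planner
sources: Hales2012, HalesDSP2012, BoroczkySzabo2016, KusnerKusnerLagariasShlosman2018
[support] (card W2, qualitative robust Fejes Tóth at position level, by compactness from the η = 0
theorems taken as hypotheses) flyspeck_L12 → Hales2012_kissingConfigCongruent → ∀ ε > 0 ∃ w₀ > 0: in
any unit packing S ⊂ ℝ³ (pairwise ≥ 1), if x ∈ S and every point of S within 1+w₀ of x (x included)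
has exactly twelve points of S within 1+w₀, then the recentred twelve-shell of x is ShellCloseTo ε
to fccKissingPattern or to hcpKissingPattern. Locality holds: Hales's Lemma 2 gap at x and at each
neighbour needs only their own twelve-shells (L12), then Lemma 9/10 classify the shell; w₀(ε) is
non-effective. [difficulty: L] -/
@[route_item "route-AtomisticToContinuum-SquareWellJamming"]
def SoftShellsAreBarlow : Prop :=
  Literature.Geometry.DiscreteGeometry.flyspeck_L12 → Literature.Geometry.DiscreteGeometry.Hales2012_kissingConfigCongruent → ∀ ε : ℝ, 0 < ε → ∃ w₀ : ℝ, 0 < w₀ ∧ ∀ (S : Set (EuclideanSpace ℝ (Fin 3))) (x : EuclideanSpace ℝ (Fin 3)), x ∈ S → (∀ y ∈ S, ∀ z ∈ S, y ≠ z → 1 ≤ dist y z) → (∀ y ∈ S, dist x y ≤ 1 + w₀ → {z ∈ S | z ≠ y ∧ dist y z ≤ 1 + w₀}.ncard = 12) → ∃ T : Finset (EuclideanSpace ℝ (Fin 3)), (↑T : Set (EuclideanSpace ℝ (Fin 3))) = (fun y => y - x) '' {y ∈ S | y ≠ x ∧ dist x y ≤ 1 + w₀} ∧ (Literature.Geometry.DiscreteGeometry.ShellCloseTo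 ε T Literature.Geometry.DiscreteGeometry.fccKissingPattern ∨ Literature.Geometry.DiscreteGeometry.ShellCloseTo ε T Literature.Geometry.DiscreteGeometry.hcpKissingPattern)

/-- item stmt-AtomisticToContinuum-5884 · support · rank 9 · closed · moot by None · by planner
sources: BlancLewin2015, Theil2006, HeitmannRadin1980
[support] (card W1/A1 analogue, vacuity guard) for 0 < w ≤ 1, s > 4, 0 < δ < 1 there is M₀ such that
for M ≥ M₀ and the flat-well potential V, for every N: a ground state exists (V is lower
semicontinuous; translation/cluster tightness) and every ground state is a unit packing (pairwise
distances ≥ 1: an overlapping particle relocated to the hull touching one extremal particle gains,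
by a Turán-type count of overlaps among > 28 points in a ball of radius 1.02). [difficulty: M] -/
@[route_item "route-AtomisticToContinuum-SquareWellJamming"]
def WallGroundStates : Prop :=
  ∀ w : ℝ, 0 < w → ∀ s : ℝ, 4 < s → ∀ δ : ℝ, 0 < δ → δ < 1 → ∃ M₀ : ℝ, ∀ M : ℝ, M₀ ≤ M → ∀ V : ℝ → ℝ, (∀ r, r < 1 → V r = M) → (∀ r, 1 ≤ r → r ≤ 1 + w → V r = -1) → (∀ r, 1 + w < r → V r = -(δ * r ^ (-s))) → ∀ N : ℕ, (∃ x : Fin N → EuclideanSpace ℝ (Fin 3), Literature.MathematicalPhysics.StatisticalMechanics.IsGroundState V x) ∧ ∀ x : Fin N → EuclideanSpace ℝ (Fin 3), Literature.MathematicalPhysics.StatisticalMechanics.IsGroundState V x → ∀ i j : Fin N, i ≠ j → 1 ≤ dist (x i) (x j)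

/-- item stmt-AtomisticToContinuum-5885 · support · rank 9 · closed · moot by None · by planner
sources: Radin1981, KubinPonsiglione2021, BeterminPetrache2017, Hales2012, BlancLewin2015
[support] the hand-over (card W5): DeepBondsAreContacts → FlatWellPeriodicMinimum →
SoftShellsAreBarlow → WallGroundStates → SquareWellCrystallizes. Mechanism = the adhesive rung's
bookkeeping run at exact contact inside L-deep good regions: budget −#bonds ≥ −6N + ½#bad (soft
kissing, tree card_le_twelve_of_norm_le for w ≤ 0.0199), un-pinned shell of depth L charged to #bad,
interfacial charging of cross tail terms (finite iff s > 4) ⇒ #bad ≤ C N^(2/3)/(½ − C″δ); extension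
comparison + per-site monotone pairing ⇒ #fcc-like sites ≤ C N^(2/3)/δ; pigeonhole ⇒ exact rotated
hcp ball of radius ≍ N^(1/9) ⇒ IsCrystallizing (rotation extraction,
tendsto_sum_of_eventually_near'); two-sided bounds ⇒ E(N)/N → e_V(hcp) and FlatWellPeriodicMinimum ⇒
HasPeriodicGroundStateEnergy. [difficulty: XL] -/
@[route_item "route-AtomisticToContinuum-SquareWellJamming"]
def AdhesiveHandover : Prop :=
  DeepBondsAreContacts → FlatWellPeriodicMinimum → SoftShellsAreBarlow → WallGroundStates → SquareWellCrystallizes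

/-- item stmt-AtomisticToContinuum-5886 · assembly · rank 1 · closed · moot by None · by planner
sources: Radin1981, BezdekBezdekConnelly1998
[assembly] DeepBondsAreContacts → FlatWellPeriodicMinimum → SoftShellsAreBarlow → WallGroundStates →
AdhesiveHandover → SquareWellCrystallizes. -/
@[route_item "route-AtomisticToContinuum-SquareWellJamming"]
def Assembly : Prop :=
  DeepBondsAreContacts → FlatWellPeriodicMinimum → SoftShellsAreBarlow → WallGroundStates → AdhesiveHandover → SquareWellCrystallizes

end Summit.AtomisticToContinuum.Crystallization.Theses.SquareWellJamming
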